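import Summits.AtomisticToContinuum.FouriersLaw.Theses.PhononMeanFreePath

/-!
# Light-cone stub, helper 3: the lattice Grönwall hierarchy (finite speed of propagation, abstract form)

Helper for the registered stub `stub_lightCone` of line `two-horizons-forecast-loss`
(crux `PhononMeanFreePath.IncoherentChannel`, stmt-AtomisticToContinuum-11811), registered sub-goal
`lightCone_lattice_gronwall`.

The deterministic mechanism behind the light cone of a nearest-neighbour chain, with a
TIME-DEPENDENT local rate. Sites `j = 0, …, n` carry non-negative `C¹` "discrepancy energies"
`e_j(s)` (padded by `e_j ≡ 0` for `j > n`), initially concentrated at site `0`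
(`e_j(0) = 0`, `j ≥ 1`), and obeying the nearest-neighbour differential inequalities
`e_j' ≤ c(s) (e_{j-1} + e_j + e_{j+1})` on `[0, T]` with a continuous rate `c ≥ 0` (for `j = 0` the
convention `0 - 1 = 0` only weakens the hypothesis). Then the far site feels the initial
discrepancy only through `n` time-ordered integrations:

  `e_n(s) ≤ e_0(0) · e^{A(s)} · A(s)^n / n!`,   `A(s) = 4 ∫₀ˢ c`,   `s ∈ [0, T]`

(`lightCone_lattice_gronwall`). Proof: the tail sums `F_k = ∑_{j ≥ k} e_j` satisfy
`F_k' ≤ 4c F_{k-1}` (`F_{-1} := F_0`), whence `F_0 ≤ F_0(0) e^{A}` (Grönwall with variable rate) and,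
inductively, `F_k ≤ F_0(0) e^{A} A^k/k!` (the comparison function has derivative
`≥ 4c · F_0(0) e^{A} A^{k-1}/(k-1)!`). With `A(s) ≲ s · (local Lipschitz factors)` this is the
super-polynomial smallness `(eA/n)^n` inside the cone `A ≪ n`.
-/

noncomputable section

namespace Summit.AtomisticToContinuum.FouriersLaw.Theorems.PhononMeanFreePath

open MeasureTheory Set Filter Topology
open scoped NNReal

section Hierarchy

variable {n : ℕ} {T : ℝ} {c : ℝ → ℝ} {e e' : ℕ → ℝ → ℝ}

/-- Index shift for the left neighbours: `∑_{j ∈ [a+1, b+1)} f(j-1) = ∑_{i ∈ [a, b)} f(i)`. -/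
theorem lightCone_sum_Ico_succ_sub_one (f : ℕ → ℝ) (a b : ℕ) :
    ∑ j ∈ Finset.Ico (a + 1) (b + 1), f (j - 1) = ∑ i ∈ Finset.Ico a b, f i := by
  rw [← Finset.sum_Ico_add' (fun j => f (j - 1)) a b 1]
  simp

/-- The left-neighbour tail sum is at most twice the previous tail sum:
`∑_{j ∈ [k, n+1)} e_{j-1} ≤ 2 ∑_{j ∈ [k-1, n+1)} e_j` (`e ≥ 0`; for `k = 0` the term `j = 0`
contributes `e_0` once more). -/
theorem lightCone_sum_pred_le (he0 : ∀ j s, 0 ≤ e j s) (k : ℕ) (s : ℝ) :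
    ∑ j ∈ Finset.Ico k (n + 1), e (j - 1) s ≤ 2 * ∑ j ∈ Finset.Ico (k - 1) (n + 1), e j s := by
  have hF0 : ∀ a, 0 ≤ ∑ j ∈ Finset.Ico a (n + 1), e j s := fun a => Finset.sum_nonneg fun j _ => he0 j s
  rcases Nat.eq_zero_or_pos k with hk | hk
  · subst hk
    rw [Finset.sum_eq_sum_Ico_succ_bot (Nat.succ_pos n), Nat.zero_sub,
      lightCone_sum_Ico_succ_sub_one (fun j => e j s) 0 n]
    have h1 : e 0 s ≤ ∑ j ∈ Finset.Ico 0 (n + 1), e j s :=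
      Finset.single_le_sum (f := fun j => e j s) (fun j _ => he0 j s) (by simp)
    have h2 : ∑ i ∈ Finset.Ico 0 n, e i s ≤ ∑ j ∈ Finset.Ico 0 (n + 1), e j s :=
      Finset.sum_le_sum_of_subset_of_nonneg (Finset.Ico_subset_Ico le_rfl (Nat.le_succ n))
        fun j _ _ => he0 j s
    linarith
  · obtain ⟨k', rfl⟩ : ∃ k', k = k' + 1 := ⟨k - 1, by omega⟩
    rw [Nat.add_sub_cancel, lightCone_sum_Ico_succ_sub_one (fun j => e j s) k' n]
    have h2 : ∑ i ∈ Finset.Ico k' n, e i s ≤ ∑ j ∈ Finset.Ico k' (n + 1), e j s :=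
      Finset.sum_le_sum_of_subset_of_nonneg (Finset.Ico_subset_Ico le_rfl (Nat.le_succ n))
        fun j _ _ => he0 j s
    linarith [hF0 k']

/-- The right-neighbour tail sum: `∑_{j ∈ [k, n+1)} e_{j+1} ≤ ∑_{j ∈ [k-1, n+1)} e_j` (padding
`e_{n+1} = 0`). -/
theorem lightCone_sum_succ_le (he0 : ∀ j s, 0 ≤ e j s) (hvan : ∀ j, n < j → ∀ s, e j s = 0) (k : ℕ) (s : ℝ) :
    ∑ j ∈ Finset.Ico k (n + 1), e (j + 1) s ≤ ∑ j ∈ Finset.Ico (k - 1) (n + 1), e j s := by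
  rcases le_or_gt k n with hk | hk
  · rw [Finset.sum_Ico_add' (fun j => e j s) k (n + 1) 1, Finset.sum_Ico_succ_top (by omega : k + 1 ≤ n + 1),
      hvan (n + 1) (Nat.lt_succ_self n) s, add_zero]
    exact Finset.sum_le_sum_of_subset_of_nonneg (Finset.Ico_subset_Ico (by omega) le_rfl) fun j _ _ => he0 j s
  · rw [Finset.Ico_eq_empty (by omega), Finset.sum_empty]
    exact Finset.sum_nonneg fun j _ => he0 j s

/-- **The tail sums close a hierarchy**: with `F_k = ∑_{j ∈ [k, n+1)} e_j`,
`F_k' = ∑_{j ∈ [k,n+1)} e_j' ≤ 4 c F_{k-1}` on `[0, T]` (`F_{-1} = F_0` by `0 - 1 = 0`). -/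
theorem lightCone_tail_deriv_le (hc0 : ∀ s, 0 ≤ c s) (he0 : ∀ j s, 0 ≤ e j s)
    (hvan : ∀ j, n < j → ∀ s, e j s = 0)
    (hloc : ∀ j, ∀ s ∈ Icc 0 T, e' j s ≤ c s * (e (j - 1) s + e j s + e (j + 1) s))
    (k : ℕ) {s : ℝ} (hs : s ∈ Icc 0 T) :
    ∑ j ∈ Finset.Ico k (n + 1), e' j s ≤ 4 * c s * ∑ j ∈ Finset.Ico (k - 1) (n + 1), e j s := by
  have h1 : ∑ j ∈ Finset.Ico k (n + 1), e' j s ≤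
      ∑ j ∈ Finset.Ico k (n + 1), c s * (e (j - 1) s + e j s + e (j + 1) s) :=
    Finset.sum_le_sum fun j _ => hloc j s hs
  refine h1.trans ?_
  rw [← Finset.mul_sum, Finset.sum_add_distrib, Finset.sum_add_distrib]
  have hA := lightCone_sum_pred_le he0 k s (n := n)
  have hB := lightCone_sum_succ_le he0 hvan k s
  have hC : ∑ j ∈ Finset.Ico k (n + 1), e j s ≤ ∑ j ∈ Finset.Ico (k - 1) (n + 1), e j s :=
    Finset.sum_le_sum_of_subset_of_nonneg (Finset.Ico_subset_Ico (Nat.sub_le k 1) le_rfl) fun j _ _ => he0 j s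
  have hc := hc0 s
  nlinarith

/-- **Grönwall step with variable rate** (the comparison lemma used twice below): if `g` is
differentiable with `g' ≤ 0` on `[0, T]`, then `g s ≤ g 0` for `s ∈ [0, T]`. -/
theorem lightCone_le_of_deriv_nonpos {g g' : ℝ → ℝ} (hg : ∀ s, HasDerivAt g (g' s) s)
    (hle : ∀ s ∈ Icc 0 T, g' s ≤ 0) {s : ℝ} (hs : s ∈ Icc 0 T) : g s ≤ g 0 := by
  have hanti : AntitoneOn g (Icc 0 T) := by
    refine antitoneOn_of_deriv_nonpos (convex_Icc 0 T) (fun x _ => (hg x).continuousAt.continuousWithinAt)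
      (fun x _ => (hg x).differentiableAt.differentiableWithinAt) fun x hx => ?_
    rw [interior_Icc] at hx
    rw [(hg x).deriv]
    exact hle x ⟨hx.1.le, hx.2.le⟩
  exact hanti ⟨le_rfl, hs.1.trans hs.2⟩ hs hs.1

/-- **The hierarchy bound for all tail sums**: `F_k(s) ≤ F_0(0) e^{A(s)} A(s)^k / k!` on `[0, T]`,
`A(s) = 4∫₀ˢ c`. -/
theorem lightCone_tail_le (hc : Continuous c) (hc0 : ∀ s, 0 ≤ c s) (he : ∀ j s, HasDerivAt (e j) (e' j s) s)
    (he0 : ∀ j s, 0 ≤ e j s) (hvan : ∀ j, n < j → ∀ s, e j s = 0)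
    (hloc : ∀ j, ∀ s ∈ Icc 0 T, e' j s ≤ c s * (e (j - 1) s + e j s + e (j + 1) s))
    (hinit : ∀ j, 1 ≤ j → e j 0 = 0) (k : ℕ) {s : ℝ} (hs : s ∈ Icc 0 T) :
    ∑ j ∈ Finset.Ico k (n + 1), e j s ≤
      (∑ j ∈ Finset.Ico 0 (n + 1), e j 0) * Real.exp (4 * ∫ r in (0:ℝ)..s, c r) *
        (4 * ∫ r in (0:ℝ)..s, c r) ^ k / k.factorial := by
  set F : ℕ → ℝ → ℝ := fun k s => ∑ j ∈ Finset.Ico k (n + 1), e j s with hF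
  set A : ℝ → ℝ := fun s => 4 * ∫ r in (0:ℝ)..s, c r with hA
  have hAd : ∀ s, HasDerivAt A (4 * c s) s := fun s =>
    (intervalIntegral.integral_hasDerivAt_right (hc.intervalIntegrable _ _)
      (hc.stronglyMeasurableAtFilter _ _) hc.continuousAt).const_mul 4
  have hA0 : A 0 = 0 := by simp [hA]
  have hAnn : ∀ s ∈ Icc 0 T, 0 ≤ A s := fun s hs =>
    mul_nonneg (by norm_num) (intervalIntegral.integral_nonneg hs.1 fun r _ => hc0 r)
  have hFd : ∀ k s, HasDerivAt (F k) (∑ j ∈ Finset.Ico k (n + 1), e' j s) s := fun k s => by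
    simp only [hF]
    exact HasDerivAt.fun_sum fun j _ => he j s
  have hF0nn : 0 ≤ F 0 0 := Finset.sum_nonneg fun j _ => he0 j 0
  have hstep : ∀ k, ∀ s ∈ Icc 0 T, ∑ j ∈ Finset.Ico k (n + 1), e' j s ≤ 4 * c s * F (k - 1) s :=
    fun k s hs => lightCone_tail_deriv_le hc0 he0 hvan hloc k hs
  -- the claim, by induction on `k`
  suffices H : ∀ k, ∀ s ∈ Icc 0 T, F k s ≤ F 0 0 * Real.exp (A s) * A s ^ k / k.factorial from H k s hs
  intro k
  induction k with
  | zero =>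
    intro s hs
    -- Grönwall: `g = F_0 e^{-A}` is non-increasing
    have hg : ∀ s, HasDerivAt (fun s => F 0 s * Real.exp (-A s))
        ((∑ j ∈ Finset.Ico 0 (n + 1), e' j s) * Real.exp (-A s) + F 0 s * (Real.exp (-A s) * -(4 * c s))) s :=
      fun s => (hFd 0 s).mul (hAd s).neg.exp
    have hle : ∀ s ∈ Icc 0 T, (∑ j ∈ Finset.Ico 0 (n + 1), e' j s) * Real.exp (-A s) +
        F 0 s * (Real.exp (-A s) * -(4 * c s)) ≤ 0 := by
      intro s hs
      have h1 := hstep 0 s hs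
      rw [Nat.zero_sub] at h1
      have hE : 0 < Real.exp (-A s) := Real.exp_pos _
      nlinarith
    have := lightCone_le_of_deriv_nonpos hg hle hs
    simp only [hA0, neg_zero, Real.exp_zero, mul_one] at this
    rw [pow_zero, mul_one, Nat.factorial_zero, Nat.cast_one, div_one]
    have hE : Real.exp (-A s) * Real.exp (A s) = 1 := by rw [← Real.exp_add]; simp
    calc F 0 s = F 0 s * Real.exp (-A s) * Real.exp (A s) := by rw [mul_assoc, hE, mul_one]
      _ ≤ F 0 0 * Real.exp (A s) := mul_le_mul_of_nonneg_right this (Real.exp_pos _).le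
  | succ k ih =>
    intro s hs
    -- comparison function `g = F_{k+1} - F_0(0) e^{A} A^{k+1}/(k+1)!`
    set M : ℝ := F 0 0 / (k + 1).factorial with hM
    have hM0 : 0 ≤ M := div_nonneg hF0nn (Nat.cast_nonneg _)
    have hg : ∀ s, HasDerivAt (fun s => F (k + 1) s - M * (Real.exp (A s) * A s ^ (k + 1)))
        ((∑ j ∈ Finset.Ico (k + 1) (n + 1), e' j s) -
          M * (Real.exp (A s) * (4 * c s) * A s ^ (k + 1) +
            Real.exp (A s) * (((k + 1 : ℕ) : ℝ) * A s ^ k * (4 * c s)))) s :=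
      fun s => (hFd (k + 1) s).sub (((hAd s).exp.mul ((hAd s).pow (k + 1))).const_mul M)
    have hle : ∀ s ∈ Icc 0 T, (∑ j ∈ Finset.Ico (k + 1) (n + 1), e' j s) -
        M * (Real.exp (A s) * (4 * c s) * A s ^ (k + 1) +
          Real.exp (A s) * (((k + 1 : ℕ) : ℝ) * A s ^ k * (4 * c s))) ≤ 0 := by
      intro s hs
      have h1 := hstep (k + 1) s hs
      rw [Nat.add_sub_cancel] at h1
      have h2 := ih s hs
      have hcs := hc0 s
      have hAs := hAnn s hs
      have hE : 0 < Real.exp (A s) := Real.exp_pos _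
      have hfac : (F 0 0 * Real.exp (A s) * A s ^ k / k.factorial) =
          M * (Real.exp (A s) * (((k + 1 : ℕ) : ℝ) * A s ^ k)) := by
        rw [hM, Nat.factorial_succ]
        push_cast
        have hk : ((k.factorial : ℕ) : ℝ) ≠ 0 := by positivity
        field_simp
      have h3 : F k s ≤ M * (Real.exp (A s) * (((k + 1 : ℕ) : ℝ) * A s ^ k)) := hfac ▸ h2
      have h4 : 0 ≤ M * (Real.exp (A s) * (4 * c s) * A s ^ (k + 1)) := by positivity
      nlinarith [mul_le_mul_of_nonneg_left h3 (by positivity : (0:ℝ) ≤ 4 * c s)]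
    have := lightCone_le_of_deriv_nonpos hg hle hs
    have hinit' : F (k + 1) 0 = 0 := Finset.sum_eq_zero fun j hj => hinit j (by
      have := (Finset.mem_Ico.1 hj).1; omega)
    simp only [hA0, hinit', Real.exp_zero, zero_pow (Nat.succ_ne_zero k), mul_zero, sub_zero] at this
    rw [hM] at this
    have : F (k + 1) s ≤ F 0 0 / ((k + 1).factorial : ℝ) * (Real.exp (A s) * A s ^ (k + 1)) := by linarith
    calc F (k + 1) s ≤ F 0 0 / ((k + 1).factorial : ℝ) * (Real.exp (A s) * A s ^ (k + 1)) := this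
      _ = F 0 0 * Real.exp (A s) * A s ^ (k + 1) / ((k + 1).factorial : ℝ) := by ring

end Hierarchy

/-- **Registered helper `lightCone_lattice_gronwall` — the lattice Grönwall hierarchy.**
Non-negative `C¹` site energies `e_j` (`e_j ≡ 0` for `j > n`, `e_j(0) = 0` for `j ≥ 1`) with
`e_j' ≤ c(s)(e_{j-1} + e_j + e_{j+1})` on `[0,T]` for a continuous rate `c ≥ 0` satisfy
`e_n(s) ≤ e_0(0) e^{A(s)} A(s)^n/n!`, `A(s) = 4∫₀ˢ c`: the site at distance `n` is reached only
through `n` time-ordered integrations (finite speed of propagation, abstract form). -/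
theorem lightCone_lattice_gronwall : ∀ (n : ℕ) (T : ℝ) (c : ℝ → ℝ) (e e' : ℕ → ℝ → ℝ), Continuous c →
    (∀ s, 0 ≤ c s) → (∀ j s, HasDerivAt (e j) (e' j s) s) → (∀ j s, 0 ≤ e j s) → (∀ j, n < j → ∀ s, e j s = 0) →
    (∀ j, ∀ s ∈ Set.Icc 0 T, e' j s ≤ c s * (e (j - 1) s + e j s + e (j + 1) s)) → (∀ j, 1 ≤ j → e j 0 = 0) →
    ∀ s ∈ Set.Icc 0 T, e n s ≤ e 0 0 * Real.exp (4 * ∫ r in (0:ℝ)..s, c r) *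
      (4 * ∫ r in (0:ℝ)..s, c r) ^ n / n.factorial := by
  intro n T c e e' hc hc0 he he0 hvan hloc hinit s hs
  have h := lightCone_tail_le hc hc0 he he0 hvan hloc hinit n hs
  rw [Nat.Ico_succ_singleton, Finset.sum_singleton, Finset.sum_eq_sum_Ico_succ_bot (Nat.succ_pos n),
    Finset.sum_eq_zero (fun j hj => hinit j (Finset.mem_Ico.1 hj).1), add_zero] at h
  exact h

end Summit.AtomisticToContinuum.FouriersLaw.Theorems.PhononMeanFreePath

end
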